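import Mathlib

/-!
# Stub `stub_partialPermDiag` for `FreeSubtorus.OrbitDimensionBound`, line `Sketch`

A *partial permutation matrix* `Y` (entries in `{0, 1}`, at most one `1` in each row and in each
column) of size `m` and rank `m - 1` becomes, after a permutation of its columns, the identity
matrix with exactly one diagonal entry replaced by `0`.

Proof: the matching "non-empty row `i` ↦ the column of its non-zero entry" is a bijection between
non-empty rows and non-empty columns; `Equiv.extendSubtype` extends it to a permutation `κ` of
`Fin m`, and then `Y i (κ j) = 0` for `i ≠ j`, i.e. `Y.submatrix id κ` is the diagonal matrix
with diagonal `d i = Y i (κ i) ∈ {0, 1}`.  By `Matrix.rank_submatrix` and `Matrix.rank_diagonal`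
the rank of `Y` is the number of non-zero `d i`, so `rank Y + 1 = m` forces exactly one `i₀`
with `d i₀ = 0`.
-/

set_option linter.dupNamespace false

namespace Summit.ValiantsHypothesis.ValiantsHypothesis.Theorems.FreeSubtorusOrbitDimensionBound

/-- In a square matrix with at most one non-zero entry in each row and in each column, the
partial matching "non-empty row ↦ the column of its non-zero entry" extends
(`Equiv.extendSubtype`) to a permutation `κ` of the indices with `Y i (κ j) ≠ 0 → i = j`,
i.e. permuting the columns by `κ` makes the matrix diagonal. [folklore] -/
theorem exists_perm_apply_ne_zero_imp_eq {m : ℕ} (Y : Matrix (Fin m) (Fin m) ℂ)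
    (hrow : ∀ i j j', Y i j ≠ 0 → Y i j' ≠ 0 → j = j')
    (hcol : ∀ i i' j, Y i j ≠ 0 → Y i' j ≠ 0 → i = i') :
    ∃ κ : Equiv.Perm (Fin m), ∀ i j, Y i (κ j) ≠ 0 → i = j := by
  classical
  -- the partial matching between non-empty rows and non-empty columns
  let e : {i : Fin m // ∃ j, Y i j ≠ 0} ≃ {j : Fin m // ∃ i, Y i j ≠ 0} :=
    { toFun := fun i => ⟨Classical.choose i.2, i.1, Classical.choose_spec i.2⟩
      invFun := fun j => ⟨Classical.choose j.2, j.1, Classical.choose_spec j.2⟩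
      left_inv := by
        rintro ⟨i, hi⟩
        apply Subtype.ext
        exact hcol _ _ _
          (Classical.choose_spec
            (⟨i, Classical.choose_spec hi⟩ : ∃ i', Y i' (Classical.choose hi) ≠ 0))
          (Classical.choose_spec hi)
      right_inv := by
        rintro ⟨j, hj⟩
        apply Subtype.ext
        exact hrow _ _ _
          (Classical.choose_spec
            (⟨j, Classical.choose_spec hj⟩ : ∃ j', Y (Classical.choose hj) j' ≠ 0))
          (Classical.choose_spec hj) }
  refine ⟨e.extendSubtype, fun i j hij => ?_⟩
  -- column `κ j` is non-empty, so row `j` is non-empty and `κ j` is its matched column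
  have hp : ∃ j', Y j j' ≠ 0 := by
    by_contra hp
    exact Equiv.extendSubtype_not_mem e j hp ⟨i, hij⟩
  have h2 : Y j (e.extendSubtype j) ≠ 0 := by
    rw [Equiv.extendSubtype_apply_of_mem e j hp]
    exact Classical.choose_spec hp
  exact hcol _ _ _ hij h2

/-- **Stub `stub_partialPermDiag`.** A partial permutation matrix (entries in `{0, 1}`, at most
one `1` per row and per column) of size `m` and rank `m - 1` is, up to a permutation of its rows
and columns, the identity matrix with exactly one diagonal `1` replaced by `0`. [folklore] -/
theorem stub_partialPermDiag :
    ∀ {m : ℕ} (Y : Matrix (Fin m) (Fin m) ℂ),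
      (∀ i j, Y i j = 0 ∨ Y i j = 1) →
      (∀ i j j', Y i j ≠ 0 → Y i j' ≠ 0 → j = j') →
      (∀ i i' j, Y i j ≠ 0 → Y i' j ≠ 0 → i = i') →
      Y.rank + 1 = m →
      ∃ (ρ κ : Equiv.Perm (Fin m)) (i₀ : Fin m),
        ∀ i j, Y (ρ i) (κ j) = if i = j ∧ i ≠ i₀ then 1 else 0 := by
  intro m Y h01 hrow hcol hrank
  classical
  obtain ⟨κ, hκ⟩ := exists_perm_apply_ne_zero_imp_eq Y hrow hcol
  -- off-diagonal vanishing, stated positively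
  have hoff : ∀ i j, i ≠ j → Y i (κ j) = 0 := fun i j hij => by
    by_contra h
    exact hij (hκ i j h)
  -- `Y` with its columns permuted by `κ` is diagonal
  have hY : Y.submatrix (Equiv.refl (Fin m)) κ = Matrix.diagonal fun i => Y i (κ i) := by
    ext i j
    by_cases hij : i = j
    · subst hij
      simp
    · rw [Matrix.diagonal_apply_ne _ hij, Matrix.submatrix_apply]
      exact hoff i j hij
  -- hence its rank is the number of non-zero diagonal entries
  have hrk : Y.rank = (Finset.univ.filter fun i => Y i (κ i) ≠ 0).card := by
    rw [← Matrix.rank_submatrix Y (Equiv.refl (Fin m)) κ, hY, Matrix.rank_diagonal,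
      Fintype.card_subtype]
  -- so exactly one diagonal entry vanishes
  have hone : (Finset.univ.filter fun i => ¬ (Y i (κ i) ≠ 0)).card = 1 := by
    have h := Finset.card_filter_add_card_filter_not
      (s := (Finset.univ : Finset (Fin m))) (fun i => Y i (κ i) ≠ 0)
    rw [Finset.card_univ, Fintype.card_fin, ← hrk] at h
    omega
  obtain ⟨i₀, hi₀⟩ := Finset.card_eq_one.mp hone
  have hzero : ∀ i, Y i (κ i) = 0 ↔ i = i₀ := fun i => by
    have h := Finset.ext_iff.mp hi₀ i
    simpa using h
  refine ⟨1, κ, i₀, fun i j => ?_⟩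
  rw [Equiv.Perm.one_apply]
  split_ifs with h
  · obtain ⟨rfl, hi⟩ := h
    rcases h01 i (κ i) with h0 | h1
    · exact absurd ((hzero i).mp h0) hi
    · exact h1
  · by_cases hij : i = j
    · subst hij
      have hi : i = i₀ := by
        by_contra hi
        exact h ⟨rfl, hi⟩
      exact (hzero i).mpr hi
    · exact hoff i j hij

end Summit.ValiantsHypothesis.ValiantsHypothesis.Theorems.FreeSubtorusOrbitDimensionBound
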